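import Summits.PneNP.PneNP.Theorems.RegularResolutionRung.Negative.OneSidedFalse

/-!
# A Prover–Adversary principle for resolution and the adversary of the unary clique CNF — crux stmt-PneNP-9816
# `RamseyUncertifiable.ResolutionUncertainty`, line `box-dag-self-gadget-lifting` (infrastructure for the lever)

(1) `not_isResRefutation_of_safe`: a generic soundness principle for the tree's resolution system — if the empty clause is
SAFE, no axiom is safe, and safety passes backward through weakening and resolution (for clauses satisfying a side condition
`Q` met by every line), then there is no refutation. (2) The adversary state for `cliqueCNF m k adj` (tree:
`RegularResolutionRung.Negative.cliqueCNF`): HEAVY blocks of a clause (`heavyBlocks`: a negative literal, or `≥ M` positive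
literals of the block), common neighbourhoods, the invariant `AdvInv` (fixed blocks = heavy blocks, fixed vertices a clique
with geometrically large common neighbourhoods, consistent with the clause), its transfer to sub-clauses, and the counting
lemma `exists_good_vertex` (one-sided `δ`-density at scale `M` + room `(k + 2^t + 2)·M ≤ δ^t·m/2` give a good vertex to fix:
Lauria–Pudlák–Rödl–Thapen arXiv:1303.3166 Cor. 12). The theorem `heavyBlockWidth` (LPRT Lemma 13 in unary) is in
`RamseyUncertifiableResolutionUncertaintyHeavyBlockWidth.lean`. [folklore Prover–Adversary technique; adaptation of
arXiv:1303.3166, Lemma 13 and Cor. 12]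
-/

-- `Summit.PneNP.PneNP.…` repeats `PneNP` by the tree's layout (summit = problem); silence the core linter as the landed siblings do.
set_option linter.dupNamespace false

namespace Summit.PneNP.PneNP.Theorems.RamseyUncertifiableResolutionUncertainty

open Literature.Computability.Complexity Literature.Computability.MetaComplexity
open Summit.PneNP.PneNP.Theorems.RegularResolutionRung.Negative

/-! ## A generic Prover–Adversary principle -/

/-- **Adversary soundness.** Let `Q` hold for every clause of `π` and let `Safe` be a predicate on clauses with:
the empty clause is safe; no clause of `φ` is safe; if a clause is safe so is every `Q`-subclause (weakening,
backwards); if a resolvent is safe then one of its (`Q`-)premises is safe. Then `π` is not a refutation of `φ`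
(every line is unsafe by induction along the derivation, but the empty clause is safe). -/
theorem not_isResRefutation_of_safe {φ : CNF ℕ} {π : List (ResLine ℕ)}
    (Q Safe : Finset (Literal ℕ) → Prop)
    (hQ : ∀ l ∈ π, Q l.clause)
    (h0 : Safe ∅)
    (h1 : ∀ c ∈ φ, ¬ Safe c.toFinset)
    (h2 : ∀ C C', Q C → C ⊆ C' → Safe C' → Safe C)
    (h3 : ∀ C D E (x : ℕ), Q C → Q D → Q E → IsResolvent C D x E → Safe E → Safe C ∨ Safe D) :
    ¬ IsResRefutation φ π := by
  rintro ⟨hder, l, hl, hle⟩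
  have key : ∀ i (hi : i < π.length), ¬ Safe (π[i]'hi).clause := by
    intro i
    induction i using Nat.strong_induction_on with
    | _ i ih =>
      intro hi hs
      have hv := hder i hi
      have hlen : (π.take i).length = i := by simp [hi.le]
      unfold IsValidResLine at hv
      split at hv
      · obtain ⟨c, hc, hceq⟩ := List.mem_map.1 hv
        exact h1 c hc (hceq ▸ hs)
      · rename_i a b v _
        obtain ⟨ha, hb, hres⟩ := hv
        have ha' : a < i := by omega
        have hb' : b < i := by omega
        rw [List.getElem_take, List.getElem_take] at hres
        rcases h3 _ _ _ _ (hQ _ (List.getElem_mem _)) (hQ _ (List.getElem_mem _)) (hQ _ (List.getElem_mem _))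
            hres hs with h | h
        · exact ih a ha' (lt_trans ha' hi) h
        · exact ih b hb' (lt_trans hb' hi) h
      · rename_i a _
        obtain ⟨ha, hsub⟩ := hv
        have ha' : a < i := by omega
        rw [List.getElem_take] at hsub
        exact ih a ha' (lt_trans ha' hi) (h2 _ _ (hQ _ (List.getElem_mem _)) hsub hs)
  obtain ⟨i, hi, rfl⟩ := List.getElem_of_mem hl
  exact key i hi (hle ▸ h0)

/-! ## Heavy blocks and the adversary invariant for `cliqueCNF` -/

section Clique

variable {m : ℕ}

/-- Block `i < k` is HEAVY in the clause `D` (over `m` vertices, threshold `M`): `D` pins block `i` by a negative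
literal `¬x_{i,v}`, or excludes at least `M` candidates of block `i` by positive literals `x_{i,v}`. -/
def heavyBlocks (m k M : ℕ) (D : Finset (Literal ℕ)) : Finset ℕ :=
  (Finset.range k).filter fun i =>
    (∃ v : Fin m, (i * m + v.val, false) ∈ D) ∨
      M ≤ ((Finset.univ : Finset (Fin m)).filter fun v : Fin m => (i * m + v.val, true) ∈ D).card

/-- The common neighbourhood of a vertex set. -/
def commonN (H : SimpleGraph (Fin m)) [DecidableRel H.Adj] (W : Finset (Fin m)) : Finset (Fin m) :=
  Finset.univ.filter fun w => ∀ u ∈ W, H.Adj u w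

/-- The clause-independent part of the adversary's state: a functional set `U` of (block, vertex) fixings whose
vertices form a clique and all of whose sub-cliques `U' ⊆ U` keep `≥ δ^{|U'|}·m` common neighbours (a hypothesis structure of
this file, not a cited fact). [folklore] -/
structure AdvCore (H : SimpleGraph (Fin m)) [DecidableRel H.Adj] (δ : ℚ) (U : Finset (ℕ × Fin m)) : Prop where
  /-- at most one fixing per block -/
  func : ∀ p ∈ U, ∀ q ∈ U, p.1 = q.1 → p = q
  /-- the fixed vertices form a clique (hence are distinct) -/
  clique : ∀ p ∈ U, ∀ q ∈ U, p ≠ q → H.Adj p.2 q.2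
  /-- every sub-clique keeps `≥ δ^{|U'|}·m` common neighbours -/
  dense : ∀ U' ⊆ U, δ ^ U'.card * (m : ℚ) ≤ ((commonN H (U'.image Prod.snd)).card : ℚ)

/-- The adversary invariant linking a state `U` to a clause `D`: `AdvCore`, the fixed blocks are exactly the heavy
blocks of `D`, no fixed vertex is excluded by `D`, and the pins of `D` agree with `U` (a hypothesis structure of this file, not a
cited fact). [folklore] -/
structure AdvInv (H : SimpleGraph (Fin m)) [DecidableRel H.Adj] (k M : ℕ) (δ : ℚ)
    (U : Finset (ℕ × Fin m)) (D : Finset (Literal ℕ)) : Prop where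
  /-- the clause-independent invariants -/
  core : AdvCore H δ U
  /-- fixed blocks are exactly the heavy blocks of `D` -/
  img : U.image Prod.fst = heavyBlocks m k M D
  /-- no fixed vertex is excluded by `D` -/
  pos : ∀ p ∈ U, (p.1 * m + p.2.val, true) ∉ D
  /-- the pins of `D` agree with the fixings -/
  pin : ∀ p ∈ U, ∀ v : Fin m, (p.1 * m + v.val, false) ∈ D → v = p.2

variable (H : SimpleGraph (Fin m)) [DecidableRel H.Adj] (k M : ℕ) (δ : ℚ)

/-- The empty clause has no heavy blocks (for `M ≥ 1`). -/
theorem heavyBlocks_empty (hM : 1 ≤ M) : heavyBlocks m k M (∅ : Finset (Literal ℕ)) = ∅ := by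
  ext i
  simp only [heavyBlocks, Finset.notMem_empty, exists_false, false_or, Finset.mem_filter,
    Finset.mem_range, iff_false, not_and, not_le]
  intro _
  simp only [Finset.filter_false, Finset.card_empty]
  omega

/-- The common neighbourhood of the empty set is everything. -/
theorem commonN_empty : commonN H ∅ = Finset.univ := by
  ext w; simp [commonN]

/-- The empty clause is safe: `U = ∅`. -/
theorem advInv_empty (hM : 1 ≤ M) : AdvInv H k M δ ∅ ∅ := by
  refine ⟨⟨?_, ?_, ?_⟩, ?_, ?_, ?_⟩
  · simp
  · simp
  · intro U' hU'
    have : U' = ∅ := Finset.subset_empty.1 hU'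
    subst this
    simp [commonN_empty]
  · rw [heavyBlocks_empty k M hM]; simp
  · simp
  · simp

/-- Membership in `heavyBlocks`. -/
theorem mem_heavyBlocks {k M : ℕ} {D : Finset (Literal ℕ)} {i : ℕ} :
    i ∈ heavyBlocks m k M D ↔ i < k ∧ ((∃ v : Fin m, (i * m + v.val, false) ∈ D) ∨
      M ≤ ((Finset.univ : Finset (Fin m)).filter fun v : Fin m => (i * m + v.val, true) ∈ D).card) := by
  simp [heavyBlocks]

/-- `heavyBlocks` is monotone in the clause. -/
theorem heavyBlocks_mono {k M : ℕ} {C D : Finset (Literal ℕ)} (h : C ⊆ D) :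
    heavyBlocks m k M C ⊆ heavyBlocks m k M D := by
  intro i hi
  rw [mem_heavyBlocks] at hi ⊢
  refine ⟨hi.1, hi.2.imp (fun ⟨v, hv⟩ => ⟨v, h hv⟩) (fun hle => hle.trans ?_)⟩
  exact Finset.card_le_card fun v hv => by
    rw [Finset.mem_filter] at hv ⊢
    exact ⟨hv.1, h hv.2⟩

/-- `AdvCore` is closed under subsets. -/
theorem AdvCore.subset {δ : ℚ} {U U' : Finset (ℕ × Fin m)} (h : AdvCore H δ U) (hsub : U' ⊆ U) :
    AdvCore H δ U' :=
  ⟨fun p hp q hq => h.func p (hsub hp) q (hsub hq), fun p hp q hq => h.clique p (hsub hp) q (hsub hq),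
    fun U'' hU'' => h.dense U'' (hU''.trans hsub)⟩

/-- TRANSFER: a core state whose blocks cover the heavy blocks of `C`, consistent with `C` on those blocks, restricts
to an adversary state for `C`. -/
theorem advInv_of_core {k M : ℕ} {δ : ℚ} {U : Finset (ℕ × Fin m)} {C : Finset (Literal ℕ)}
    (hcore : AdvCore H δ U) (hheavy : heavyBlocks m k M C ⊆ U.image Prod.fst)
    (hpos : ∀ p ∈ U, p.1 ∈ heavyBlocks m k M C → (p.1 * m + p.2.val, true) ∉ C)
    (hpin : ∀ p ∈ U, p.1 ∈ heavyBlocks m k M C → ∀ v : Fin m, (p.1 * m + v.val, false) ∈ C → v = p.2) :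
    AdvInv H k M δ (U.filter fun p => p.1 ∈ heavyBlocks m k M C) C := by
  refine ⟨hcore.subset H (Finset.filter_subset _ _), ?_, ?_, ?_⟩
  · ext i
    simp only [Finset.mem_image, Finset.mem_filter]
    constructor
    · rintro ⟨p, ⟨-, hp⟩, rfl⟩; exact hp
    · intro hi
      obtain ⟨p, hp, rfl⟩ := Finset.mem_image.1 (hheavy hi)
      exact ⟨p, ⟨hp, hi⟩, rfl⟩
  · intro p hp
    rw [Finset.mem_filter] at hp
    exact hpos p hp.1 hp.2
  · intro p hp
    rw [Finset.mem_filter] at hp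
    exact hpin p hp.1 hp.2

/-! ## Counting: edge counts, bad vertices, the good extension vertex -/

/-- Ordered edge count as a sum of degrees into `B`. -/
theorem card_interedges_eq_sum (A B : Finset (Fin m)) :
    (H.interedges A B).card = ∑ a ∈ A, (B.filter fun b => H.Adj a b).card := by
  rw [SimpleGraph.interedges_def, Finset.card_filter, Finset.sum_product]
  refine Finset.sum_congr rfl fun a _ => ?_
  rw [Finset.card_filter]

/-- Vertices with density `< δ` into `B`. -/
def badSet (B : Finset (Fin m)) : Finset (Fin m) :=
  Finset.univ.filter fun u => (((B.filter fun b => H.Adj u b).card : ℚ) < δ * B.card)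

/-- One-sided density at scale `M` leaves fewer than `M` bad vertices for every `M`-large set `B`. -/
theorem card_badSet_lt (hM : 1 ≤ M)
    (hdense : ∀ A B : Finset (Fin m), M ≤ A.card → M ≤ B.card → δ ≤ H.edgeDensity A B)
    {B : Finset (Fin m)} (hB : M ≤ B.card) : (badSet H δ B).card < M := by
  by_contra hge
  push Not at hge
  obtain ⟨A, hA, hAcard⟩ := Finset.exists_subset_card_eq hge
  have hd := hdense A B hAcard.ge hB
  rw [SimpleGraph.edgeDensity_def] at hd
  have hBpos : (0 : ℚ) < B.card := by exact_mod_cast lt_of_lt_of_le (Nat.lt_of_lt_of_le Nat.zero_lt_one hM) hB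
  have hApos : (0 : ℚ) < A.card := by rw [hAcard]; exact_mod_cast Nat.lt_of_lt_of_le Nat.zero_lt_one hM
  have hAne : A.Nonempty := Finset.card_pos.1 (by rw [hAcard]; omega)
  have hsum : ((H.interedges A B).card : ℚ) < δ * (A.card * B.card) := by
    rw [card_interedges_eq_sum, Nat.cast_sum]
    calc (∑ a ∈ A, ((B.filter fun b => H.Adj a b).card : ℚ))
        < ∑ a ∈ A, δ * B.card := by
          refine Finset.sum_lt_sum_of_nonempty hAne fun a ha => ?_
          have := hA ha
          simp only [badSet, Finset.mem_filter, Finset.mem_univ, true_and] at this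
          exact this
      _ = δ * (A.card * B.card) := by rw [Finset.sum_const, nsmul_eq_mul]; ring
  rw [le_div_iff₀ (by positivity)] at hd
  linarith

/-- The common neighbourhood of `insert u W` is the part of that of `W` adjacent to `u`. -/
theorem commonN_insert (u : Fin m) (W : Finset (Fin m)) :
    commonN H (insert u W) = (commonN H W).filter fun b => H.Adj u b := by
  ext w
  simp only [commonN, Finset.mem_filter, Finset.mem_univ, true_and, Finset.forall_mem_insert]
  tauto

/-- A functional state has as many fixings as fixed blocks. -/
theorem card_image_fst_of_functional {U : Finset (ℕ × Fin m)} (hf : ∀ p ∈ U, ∀ q ∈ U, p.1 = q.1 → p = q) :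
    (U.image Prod.fst).card = U.card :=
  Finset.card_image_of_injOn fun p hp q hq h => hf p hp q hq h

/-- **The good vertex** (LPRT Cor. 12 counting): with room for `t` fixings and at most `t - 1` blocks fixed, outside any
`M`-small forbidden set there is a common neighbour of the fixed clique that is `δ`-dense into the common neighbourhood of
every sub-clique. -/
theorem exists_good_vertex {t : ℕ} {U : Finset (ℕ × Fin m)} (hcore : AdvCore H δ U) (hUt : U.card + 1 ≤ t)
    (X : Finset (Fin m)) (hX : X.card ≤ M) (hδ : 0 < δ) (hδ1 : δ ≤ 1) (hM : 1 ≤ M)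
    (hdense : ∀ A B : Finset (Fin m), M ≤ A.card → M ≤ B.card → δ ≤ H.edgeDensity A B)
    (hroom : ((k + 2 ^ t + 2) * M : ℚ) ≤ δ ^ t * m / 2) :
    ∃ u ∈ commonN H (U.image Prod.snd), u ∉ X ∧
      ∀ U' ⊆ U, δ * ((commonN H (U'.image Prod.snd)).card : ℚ) ≤
        (((commonN H (U'.image Prod.snd)).filter fun b => H.Adj u b).card : ℚ) := by
  -- every sub-clique has an `M`-large common neighbourhood
  have hlarge : ∀ U' ⊆ U, (M : ℚ) ≤ (commonN H (U'.image Prod.snd)).card ∧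
      δ ^ t * (m : ℚ) ≤ (commonN H (U'.image Prod.snd)).card := by
    intro U' hU'
    have h1 := hcore.dense U' hU'
    have hcard : U'.card ≤ t := le_trans (Finset.card_le_card hU') (by omega)
    have hpow : δ ^ t ≤ δ ^ U'.card := pow_le_pow_of_le_one hδ.le hδ1 hcard
    have hm0 : (0 : ℚ) ≤ m := Nat.cast_nonneg m
    have h2 : δ ^ t * (m : ℚ) ≤ (commonN H (U'.image Prod.snd)).card :=
      le_trans (mul_le_mul_of_nonneg_right hpow hm0) h1
    refine ⟨le_trans ?_ h2, h2⟩
    have : (M : ℚ) ≤ (k + 2 ^ t + 2) * M := by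
      have hM0 : (0 : ℚ) ≤ M := Nat.cast_nonneg M
      nlinarith [show (0:ℚ) ≤ (k : ℚ) from Nat.cast_nonneg k, show (1:ℚ) ≤ 2 ^ t from one_le_pow₀ (by norm_num)]
    linarith
  -- the forbidden vertices
  classical
  set Bad : Finset (Fin m) :=
    X ∪ U.powerset.biUnion fun U' => badSet H δ (commonN H (U'.image Prod.snd)) with hBad
  have hBadcard : (Bad.card : ℚ) ≤ M + 2 ^ t * M := by
    have h1 : Bad.card ≤ X.card + (U.powerset.biUnion fun U' => badSet H δ (commonN H (U'.image Prod.snd))).card :=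
      Finset.card_union_le _ _
    have h2 : (U.powerset.biUnion fun U' => badSet H δ (commonN H (U'.image Prod.snd))).card ≤
        U.powerset.card * M := by
      refine le_trans Finset.card_biUnion_le ?_
      rw [Finset.card_eq_sum_ones U.powerset, Finset.sum_mul, one_mul]
      refine Finset.sum_le_sum fun U' hU' => ?_
      have hsub : U' ⊆ U := Finset.mem_powerset.1 hU'
      exact (card_badSet_lt H M δ hM hdense (by exact_mod_cast (hlarge U' hsub).1)).le
    rw [Finset.card_powerset] at h2
    have h3 : 2 ^ U.card ≤ 2 ^ t := Nat.pow_le_pow_right (by norm_num) (by omega)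
    have h4 : (Bad.card : ℚ) ≤ X.card + 2 ^ U.card * M := by exact_mod_cast le_trans h1 (Nat.add_le_add_left h2 _)
    have h5 : ((2 ^ U.card * M : ℕ) : ℚ) ≤ 2 ^ t * M := by exact_mod_cast Nat.mul_le_mul_right M h3
    have h6 : (X.card : ℚ) ≤ M := by exact_mod_cast hX
    push_cast at h4 h5 ⊢
    linarith
  -- the common neighbourhood of the whole clique is larger than that
  set W := commonN H (U.image Prod.snd) with hW
  have hWcard : δ ^ t * (m : ℚ) ≤ W.card := (hlarge U subset_rfl).2
  have hlt : Bad.card < W.card := by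
    have : (Bad.card : ℚ) < W.card := by
      have hM0 : (0 : ℚ) ≤ M := Nat.cast_nonneg M
      have hk0 : (0 : ℚ) ≤ k := Nat.cast_nonneg k
      nlinarith [hBadcard, hWcard, hroom, show (1 : ℚ) ≤ M by exact_mod_cast hM]
    exact_mod_cast this
  obtain ⟨u, hu⟩ : (W \ Bad).Nonempty := by
    rw [← Finset.card_pos]
    have := Finset.le_card_sdiff Bad W
    omega
  rw [Finset.mem_sdiff] at hu
  refine ⟨u, hu.1, fun hx => hu.2 (Finset.mem_union_left _ hx), fun U' hU' => ?_⟩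
  have hnot : u ∉ badSet H δ (commonN H (U'.image Prod.snd)) := fun hb =>
    hu.2 (Finset.mem_union_right _ (Finset.mem_biUnion.2 ⟨U', Finset.mem_powerset.2 hU', hb⟩))
  simp only [badSet, Finset.mem_filter, Finset.mem_univ, true_and, not_lt] at hnot
  exact hnot

/-- Fixing a good vertex for an unfixed block keeps the core invariants. -/
theorem advCore_insert {U : Finset (ℕ × Fin m)} {i : ℕ} {u : Fin m} (hcore : AdvCore H δ U) (hδ : 0 ≤ δ)
    (hi : i ∉ U.image Prod.fst) (hu : u ∈ commonN H (U.image Prod.snd))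
    (hgood : ∀ U' ⊆ U, δ * ((commonN H (U'.image Prod.snd)).card : ℚ) ≤
        (((commonN H (U'.image Prod.snd)).filter fun b => H.Adj u b).card : ℚ)) :
    AdvCore H δ (insert (i, u) U) := by
  have hiU : ∀ q ∈ U, q.1 ≠ i := fun q hq h => hi (Finset.mem_image.2 ⟨q, hq, h⟩)
  have huadj : ∀ q ∈ U, H.Adj q.2 u := by
    intro q hq
    simp only [commonN, Finset.mem_filter, Finset.mem_univ, true_and] at hu
    exact hu q.2 (Finset.mem_image.2 ⟨q, hq, rfl⟩)
  refine ⟨?_, ?_, ?_⟩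
  · intro p hp q hq hpq
    rw [Finset.mem_insert] at hp hq
    rcases hp with rfl | hp <;> rcases hq with rfl | hq
    · rfl
    · exact absurd hpq.symm (hiU q hq)
    · exact absurd hpq (hiU p hp)
    · exact hcore.func p hp q hq hpq
  · intro p hp q hq hpq
    rw [Finset.mem_insert] at hp hq
    rcases hp with rfl | hp <;> rcases hq with rfl | hq
    · exact absurd rfl hpq
    · exact (huadj q hq).symm
    · exact huadj p hp
    · exact hcore.clique p hp q hq hpq
  · intro U' hU'
    by_cases hmem : (i, u) ∈ U'
    · set V := U'.erase (i, u) with hV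
      have hsub : V ⊆ U := by
        intro q hq
        rw [hV, Finset.mem_erase] at hq
        rcases Finset.mem_insert.1 (hU' hq.2) with h | h
        · exact absurd h hq.1
        · exact h
      have hnot : (i, u) ∉ V := by simp [hV]
      have hU'eq : U' = insert (i, u) V := (Finset.insert_erase hmem).symm
      rw [hU'eq, Finset.card_insert_of_notMem hnot, Finset.image_insert, commonN_insert, pow_succ]
      have h1 := hcore.dense _ hsub
      have h2 := hgood _ hsub
      calc δ ^ V.card * δ * (m : ℚ) = δ * (δ ^ V.card * m) := by ring
        _ ≤ δ * ((commonN H (V.image Prod.snd)).card : ℚ) := mul_le_mul_of_nonneg_left h1 hδ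
        _ ≤ _ := h2
    · have hsub : U' ⊆ U := by
        intro q hq
        rcases Finset.mem_insert.1 (hU' hq) with h | h
        · exact absurd (h ▸ hq) hmem
        · exact h
      exact hcore.dense U' hsub

/-- **Registered form of `exists_good_vertex`** (closed statement; the sub-goal registered on the crux item for this support
file): one-sided `δ`-density at scale `M` (`0 < δ ≤ 1`, `1 ≤ M`) and room `(k + 2^t + 2)·M ≤ δ^t·m/2` give, for every core
state `U` with `|U| + 1 ≤ t` and every forbidden set `X` of size `≤ M`, a common neighbour of the fixed clique outside `X` that
is `δ`-dense into the common neighbourhood of every sub-clique. [folklore] -/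
theorem advGoodVertex :
    ∀ (m k M t : ℕ) (δ : ℚ) (H : SimpleGraph (Fin m)) [DecidableRel H.Adj] (U : Finset (ℕ × Fin m)) (X : Finset (Fin m)),
      AdvCore H δ U → U.card + 1 ≤ t → X.card ≤ M → 0 < δ → δ ≤ 1 → 1 ≤ M →
      (∀ A B : Finset (Fin m), M ≤ A.card → M ≤ B.card → δ ≤ H.edgeDensity A B) →
      ((k + 2 ^ t + 2) * M : ℚ) ≤ δ ^ t * m / 2 →
      ∃ u ∈ commonN H (U.image Prod.snd), u ∉ X ∧
        ∀ U' ⊆ U, δ * ((commonN H (U'.image Prod.snd)).card : ℚ) ≤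
          (((commonN H (U'.image Prod.snd)).filter fun b => H.Adj u b).card : ℚ) :=
  fun _ k M _ δ H _ _ X hcore hUt hX hδ hδ1 hM hdense hroom =>
    exists_good_vertex H k M δ hcore hUt X hX hδ hδ1 hM hdense hroom

end Clique

end Summit.PneNP.PneNP.Theorems.RamseyUncertifiableResolutionUncertainty
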